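import Summits.Ventures.Crystal3D.Theorems.StickyWulffConstantNoReconstructionGainLineCount
import HarnessLib

/-!
# Bond lines through an OFF-CENTRE slab sample with an arbitrary height window: the lattice-free
# per-class count (transport of `…NoReconstructionGainLineCount`)

HONEST FRAMING. Part of the venture `Summits/Ventures/Crystal3D` (cell `crystal3d-full`), helper for the
crux `GenericWallFloor` (stmt-Ventures-19480) of `route-Ventures-StickyWulffConstant`, line `WallLedgerG`
(planner cf-p1 gen 16), registered stub `stub_affineSampleDeficit` (the clamped slab sample of a MOVED fcc
lattice counts its two flat faces).  Pure Euclidean geometry and counting in `ℝ³`; nothing about packings.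

The landed per-class count `sqrt_two_mul_abs_inner_mul_pi_mul_sq_le_card` (line `adhesion` of the crux
`NoReconstructionGain`) is stated for the ORIGIN-centred slab sample `{−2R ≤ ⟪p,ν⟫ ≤ −R, ‖p‖² − ⟪p,ν⟫² ≤ ρ²}`
and a LINEAR frame `a•Ea + b•Eb + t•W`.  Pulling the clamped sample of a moved lattice `A·Λ₀ + t` back
through the rigid motion produces the same problem with an OFFSET `s` (the frame becomes
`a•Ea + b•Eb + t•W + s`) and an arbitrary height WINDOW `[lo, lo + R]`.  This file proves that version:

* `lateralSq_sub_smul` — the lateral part `‖v‖² − ⟪v,ν⟫²` is unchanged by `v ↦ v − c•ν`;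
* `exists_int_mem_slabSample_window` — mid-plane transversal for the window `[lo, lo + R]`
  (translation of `exists_int_mem_slabSample` along `ν`);
* `lineCount_offset_window` — **Theorem.** `ν` unit, `1 ≤ R ≤ ρ`, `Ea, Eb` of norm `≤ 1`, `W` unit with
  `det(Ea, Eb, W)² = 1/2`, `s` ANY offset, `lo` ANY window base.  If `T ⊆ ℤ²` contains every `(a, b)` for
  which some integer `t` puts `a•Ea + b•Eb + t•W + s` in `{lo ≤ ⟪p,ν⟫ ≤ lo + R, ‖p‖² − ⟪p,ν⟫² ≤ ρ²}`,
  then `√2 |⟪W,ν⟫| π ρ² − 10 √2 π ρ ≤ #T` — the SAME constant as the centred case, uniform in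
  `ν, s, lo` and the line class.

Proof: as in the centred file — the crossings of the lines `(a, b) + ℤW + s` with the mid-plane
`⟪·,ν⟫ = lo + R/2` form the affine lattice `c₀ + aX + bY` in `ν^⊥` with
`c₀ = s + ((lo + R/2 − ⟪s,ν⟫)/⟪W,ν⟫) W − (lo + R/2) ν`; plane coordinates, the shear identity and the
affine disc count finish verbatim.

WHAT THIS IS NOT: no lattice enumeration, no deficiency; the crux itself is untouched; rung F-C1 not moved.
-/

noncomputable section

namespace Summit.Ventures.Crystal3D.Theorems

open Summit.Ventures.Crystal3D Matrix
open scoped InnerProductSpace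

/-- The lateral part `‖v‖² − ⟪v, ν⟫²` (`ν` unit) is invariant under translation along `ν`. -/
theorem lateralSq_sub_smul (ν v : EuclideanSpace ℝ (Fin 3)) (hν : ‖ν‖ = 1) (c : ℝ) :
    ‖v - c • ν‖ ^ 2 - ⟪v - c • ν, ν⟫_ℝ ^ 2 = ‖v‖ ^ 2 - ⟪v, ν⟫_ℝ ^ 2 := by
  have hνν : ⟪ν, ν⟫_ℝ = 1 := by rw [real_inner_self_eq_norm_sq, hν, one_pow]
  rw [← norm_sub_inner_smul_sq ν _ hν, ← norm_sub_inner_smul_sq ν v hν]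
  congr 1
  rw [inner_sub_left, inner_smul_left]
  simp only [conj_trivial]
  rw [hνν, mul_one, sub_smul]
  congr 1
  abel

/-- **Mid-plane transversal, arbitrary window.** `ν` unit, `‖W‖ ≤ 1`, `⟪W, ν⟫ ≠ 0`, `R ≥ 1`, `ρ ≥ 1`,
`lo` arbitrary.  If the crossing point `Q` of the line `P₀ + ℝ W` with the mid-plane
`⟪·, ν⟫ = lo + R/2` has lateral norm `≤ ρ − 1`, then some INTEGER parameter `t` puts `P₀ + t W` in the
slab sample `{lo ≤ ⟪p,ν⟫ ≤ lo + R, ‖p‖² − ⟪p,ν⟫² ≤ ρ²}`. -/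
theorem exists_int_mem_slabSample_window (ν P₀ W : EuclideanSpace ℝ (Fin 3)) (hν : ‖ν‖ = 1)
    (hW : ‖W‖ ≤ 1) (hα : ⟪W, ν⟫_ℝ ≠ 0) (R ρ lo : ℝ) (hR : 1 ≤ R) (hρ : 1 ≤ ρ)
    (hQ : ‖P₀ + ((lo + R / 2 - ⟪P₀, ν⟫_ℝ) / ⟪W, ν⟫_ℝ) • W‖ ^ 2 -
      ⟪P₀ + ((lo + R / 2 - ⟪P₀, ν⟫_ℝ) / ⟪W, ν⟫_ℝ) • W, ν⟫_ℝ ^ 2 ≤ (ρ - 1) ^ 2) :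
    ∃ t : ℤ, lo ≤ ⟪P₀ + (t : ℝ) • W, ν⟫_ℝ ∧ ⟪P₀ + (t : ℝ) • W, ν⟫_ℝ ≤ lo + R ∧
      ‖P₀ + (t : ℝ) • W‖ ^ 2 - ⟪P₀ + (t : ℝ) • W, ν⟫_ℝ ^ 2 ≤ ρ ^ 2 := by
  have hνν : ⟪ν, ν⟫_ℝ = 1 := by rw [real_inner_self_eq_norm_sq, hν, one_pow]
  -- translate the base point along `ν` so that the window becomes `[−2R, −R]`
  set P₁ : EuclideanSpace ℝ (Fin 3) := P₀ - (lo + 2 * R) • ν with hP₁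
  have hP₁ν : ⟪P₁, ν⟫_ℝ = ⟪P₀, ν⟫_ℝ - (lo + 2 * R) := by
    rw [hP₁, inner_sub_left, inner_smul_left]; simp only [conj_trivial]; rw [hνν, mul_one]
  have hpar : -(⟪P₁, ν⟫_ℝ + 3 * R / 2) / ⟪W, ν⟫_ℝ = (lo + R / 2 - ⟪P₀, ν⟫_ℝ) / ⟪W, ν⟫_ℝ := by
    rw [hP₁ν]; congr 1; ring
  have hshift : ∀ c : ℝ, P₁ + c • W = (P₀ + c • W) - (lo + 2 * R) • ν := by
    intro c; rw [hP₁]; abel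
  have hQ' : ‖P₁ + (-(⟪P₁, ν⟫_ℝ + 3 * R / 2) / ⟪W, ν⟫_ℝ) • W‖ ^ 2 -
      ⟪P₁ + (-(⟪P₁, ν⟫_ℝ + 3 * R / 2) / ⟪W, ν⟫_ℝ) • W, ν⟫_ℝ ^ 2 ≤ (ρ - 1) ^ 2 := by
    rw [hpar, hshift, lateralSq_sub_smul ν _ hν]
    exact hQ
  obtain ⟨t, h1, h2, h3⟩ := exists_int_mem_slabSample ν P₁ W hν hW hα R ρ hR hρ hQ'
  have hin : ⟪P₁ + (t : ℝ) • W, ν⟫_ℝ = ⟪P₀ + (t : ℝ) • W, ν⟫_ℝ - (lo + 2 * R) := by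
    rw [hshift, inner_sub_left, inner_smul_left]; simp only [conj_trivial]; rw [hνν, mul_one]
  refine ⟨t, ?_, ?_, ?_⟩
  · rw [hin] at h1; linarith
  · rw [hin] at h2; linarith
  · rw [hshift, lateralSq_sub_smul ν _ hν] at h3; exact h3

/-- **Per-class line count with an offset and an arbitrary window (lattice-free).** `ν` unit,
`1 ≤ R ≤ ρ`; `Ea, Eb` of norm `≤ 1`, `W` unit, `det(Ea, Eb, W)² = 1/2`; `s` any offset, `lo` any window
base.  If `T ⊆ ℤ²` contains every `(a, b)` for which some integer `t` puts `a•Ea + b•Eb + t•W + s` in the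
slab sample `{lo ≤ ⟪p,ν⟫ ≤ lo + R, ‖p‖² − ⟪p,ν⟫² ≤ ρ²}`, then `√2 |⟪W,ν⟫| π ρ² − 10 √2 π ρ ≤ #T`. -/
theorem lineCount_offset_window (ν : EuclideanSpace ℝ (Fin 3)) (hν : ‖ν‖ = 1)
    (R ρ lo : ℝ) (hR : 1 ≤ R) (hρ : R ≤ ρ) (Ea Eb W s : EuclideanSpace ℝ (Fin 3))
    (hEa : ‖Ea‖ ≤ 1) (hEb : ‖Eb‖ ≤ 1) (hW : ‖W‖ = 1)
    (hdet : (Matrix.det ![WithLp.ofLp Ea, WithLp.ofLp Eb, WithLp.ofLp W]) ^ 2 = 1 / 2)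
    (T : Finset (ℤ × ℤ))
    (hT : ∀ a b t : ℤ,
      lo ≤ ⟪(a : ℝ) • Ea + (b : ℝ) • Eb + (t : ℝ) • W + s, ν⟫_ℝ →
      ⟪(a : ℝ) • Ea + (b : ℝ) • Eb + (t : ℝ) • W + s, ν⟫_ℝ ≤ lo + R →
      ‖(a : ℝ) • Ea + (b : ℝ) • Eb + (t : ℝ) • W + s‖ ^ 2 -
          ⟪(a : ℝ) • Ea + (b : ℝ) • Eb + (t : ℝ) • W + s, ν⟫_ℝ ^ 2 ≤ ρ ^ 2 →
      (a, b) ∈ T) :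
    Real.sqrt 2 * |⟪W, ν⟫_ℝ| * Real.pi * ρ ^ 2 - 10 * Real.sqrt 2 * Real.pi * ρ ≤ (T.card : ℝ) := by
  have hρ1 : 1 ≤ ρ := hR.trans hρ
  have hρ0 : 0 ≤ ρ := by linarith
  have h2pos : 0 < Real.sqrt 2 := Real.sqrt_pos.2 (by norm_num)
  have h2sq : Real.sqrt 2 ^ 2 = 2 := Real.sq_sqrt (by norm_num)
  have hTnn : (0 : ℝ) ≤ (T.card : ℝ) := Nat.cast_nonneg _
  set α : ℝ := ⟪W, ν⟫_ℝ with hαdef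
  set m : ℝ := lo + R / 2 with hmdef
  -- |α| ≤ 1, |⟪Ea,ν⟫| ≤ 1, |⟪Eb,ν⟫| ≤ 1
  have hαle : |α| ≤ 1 := by
    have h := abs_real_inner_le_norm W ν; rw [hW, hν, one_mul] at h; exact h
  have hEaν : |⟪Ea, ν⟫_ℝ| ≤ 1 := by
    have h := abs_real_inner_le_norm Ea ν; rw [hν, mul_one] at h; exact h.trans hEa
  have hEbν : |⟪Eb, ν⟫_ℝ| ≤ 1 := by
    have h := abs_real_inner_le_norm Eb ν; rw [hν, mul_one] at h; exact h.trans hEb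
  by_cases hα0 : α = 0
  · rw [hα0, abs_zero, mul_zero, zero_mul, zero_mul, zero_sub]
    have : 0 ≤ 10 * Real.sqrt 2 * Real.pi * ρ := by positivity
    linarith
  have hαpos : 0 < |α| := abs_pos.2 hα0
  -- the oblique projections and the (lateral) centre
  set X : EuclideanSpace ℝ (Fin 3) := Ea - (⟪Ea, ν⟫_ℝ / α) • W with hX
  set Y : EuclideanSpace ℝ (Fin 3) := Eb - (⟪Eb, ν⟫_ℝ / α) • W with hY
  set c₀ : EuclideanSpace ℝ (Fin 3) := s + ((m - ⟪s, ν⟫_ℝ) / α) • W - m • ν with hc₀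
  have hνν : ⟪ν, ν⟫_ℝ = 1 := by rw [real_inner_self_eq_norm_sq, hν, one_pow]
  have hXν : ⟪X, ν⟫_ℝ = 0 := by
    rw [hX, inner_sub_left, inner_smul_left]; simp only [conj_trivial]; rw [← hαdef]; field_simp; ring
  have hYν : ⟪Y, ν⟫_ℝ = 0 := by
    rw [hY, inner_sub_left, inner_smul_left]; simp only [conj_trivial]; rw [← hαdef]; field_simp; ring
  have hc₀ν : ⟪c₀, ν⟫_ℝ = 0 := by
    rw [hc₀, inner_sub_left, inner_add_left, inner_smul_left, inner_smul_left]; simp only [conj_trivial]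
    rw [hνν, ← hαdef]; field_simp; ring
  -- norms of X, Y: |α| ‖X‖ ≤ 2
  have hXn : |α| * ‖X‖ ≤ 2 := by
    have h1 : |α| * ‖X‖ = ‖α • Ea - ⟪Ea, ν⟫_ℝ • W‖ := by
      rw [← Real.norm_eq_abs, ← norm_smul, hX, smul_sub, smul_smul, mul_div_cancel₀ _ hα0]
    rw [h1]
    have h2 : ‖α • Ea - ⟪Ea, ν⟫_ℝ • W‖ ≤ |α| * ‖Ea‖ + |⟪Ea, ν⟫_ℝ| * ‖W‖ := by
      calc ‖α • Ea - ⟪Ea, ν⟫_ℝ • W‖ ≤ ‖α • Ea‖ + ‖⟪Ea, ν⟫_ℝ • W‖ := norm_sub_le _ _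
        _ = |α| * ‖Ea‖ + |⟪Ea, ν⟫_ℝ| * ‖W‖ := by
            rw [norm_smul, norm_smul, Real.norm_eq_abs, Real.norm_eq_abs]
    rw [hW, mul_one] at h2
    nlinarith [abs_nonneg α, norm_nonneg Ea, abs_nonneg ⟪Ea, ν⟫_ℝ]
  have hYn : |α| * ‖Y‖ ≤ 2 := by
    have h1 : |α| * ‖Y‖ = ‖α • Eb - ⟪Eb, ν⟫_ℝ • W‖ := by
      rw [← Real.norm_eq_abs, ← norm_smul, hY, smul_sub, smul_smul, mul_div_cancel₀ _ hα0]
    rw [h1]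
    have h2 : ‖α • Eb - ⟪Eb, ν⟫_ℝ • W‖ ≤ |α| * ‖Eb‖ + |⟪Eb, ν⟫_ℝ| * ‖W‖ := by
      calc ‖α • Eb - ⟪Eb, ν⟫_ℝ • W‖ ≤ ‖α • Eb‖ + ‖⟪Eb, ν⟫_ℝ • W‖ := norm_sub_le _ _
        _ = |α| * ‖Eb‖ + |⟪Eb, ν⟫_ℝ| * ‖W‖ := by
            rw [norm_smul, norm_smul, Real.norm_eq_abs, Real.norm_eq_abs]
    rw [hW, mul_one] at h2
    nlinarith [abs_nonneg α, norm_nonneg Eb, abs_nonneg ⟪Eb, ν⟫_ℝ]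
  set r : ℝ := ‖X‖ + ‖Y‖ with hr
  have hr0 : 0 ≤ r := by positivity
  have hαr : |α| * (1 + r) ≤ 5 := by rw [hr]; nlinarith
  -- the small-ρ case is trivial
  by_cases hrρ : ρ - 1 < r
  · have h1 : |α| * ρ ≤ 5 := by nlinarith
    have h3 : 0 ≤ Real.sqrt 2 * Real.pi * ρ := by positivity
    have h4 : Real.sqrt 2 * |α| * Real.pi * ρ ^ 2 = (Real.sqrt 2 * Real.pi * ρ) * (|α| * ρ) := by
      ring
    have h5 : Real.sqrt 2 * |α| * Real.pi * ρ ^ 2 ≤ (Real.sqrt 2 * Real.pi * ρ) * 5 := by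
      rw [h4]; exact mul_le_mul_of_nonneg_left h1 h3
    nlinarith
  push Not at hrρ
  -- plane coordinates
  obtain ⟨A, β, hAβ, hdetA, hAf⟩ := exists_planeCoordinates ν X Y c₀ hν hXν hYν hc₀ν
  -- Gram identity ⇒ 2 α² det(A)² = 1
  have hgram := sq_mul_gram_shear_euclidean Ea Eb W ν hα0
  rw [← hαdef, ← hX, ← hY, hdet, hν, one_pow, mul_one, ← hdetA] at hgram
  have hdetabs : Real.sqrt 2 * |α| * |A.det| = 1 := by
    have hnn : 0 ≤ Real.sqrt 2 * |α| * |A.det| := by positivity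
    have hsq : (Real.sqrt 2 * |α| * |A.det|) ^ 2 = 1 := by
      rw [mul_pow, mul_pow, h2sq, sq_abs, sq_abs]; linarith
    exact (pow_eq_one_iff_of_nonneg hnn (by norm_num)).1 hsq
  have hAdet : A.det ≠ 0 := by
    intro h; rw [h, abs_zero, mul_zero] at hdetabs; exact zero_ne_one hdetabs
  -- the affine disc count
  have hbound : ∀ f : Fin 2 → ℝ, (∀ i, 0 ≤ f i ∧ f i < 1) →
      (A.mulVec f 0) ^ 2 + (A.mulVec f 1) ^ 2 ≤ r ^ 2 := by
    intro f hf
    rw [hAf]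
    have h0 := hf 0; have h1 := hf 1
    have hle : ‖f 0 • X + f 1 • Y‖ ≤ r := by
      calc ‖f 0 • X + f 1 • Y‖ ≤ ‖f 0 • X‖ + ‖f 1 • Y‖ := norm_add_le _ _
        _ = |f 0| * ‖X‖ + |f 1| * ‖Y‖ := by rw [norm_smul, norm_smul, Real.norm_eq_abs, Real.norm_eq_abs]
        _ ≤ 1 * ‖X‖ + 1 * ‖Y‖ := by
            gcongr
            · rw [abs_of_nonneg h0.1]; exact h0.2.le
            · rw [abs_of_nonneg h1.1]; exact h1.2.le
        _ = r := by rw [hr]; ring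
    exact pow_le_pow_left₀ (norm_nonneg _) hle 2
  have hdisc := affine_disc_count A hAdet β 0 r (ρ - 1) hr0 hrρ hbound T ?_
  swap
  · intro i j hij
    simp only [Pi.zero_apply, sub_zero] at hij
    -- the mid-plane crossing of the line (i, j) has lateral norm ≤ ρ - 1
    have hlat : ‖c₀ + (i : ℝ) • X + (j : ℝ) • Y‖ ^ 2 ≤ (ρ - 1) ^ 2 := by rw [hAβ]; exact hij
    set P₀ : EuclideanSpace ℝ (Fin 3) := (i : ℝ) • Ea + (j : ℝ) • Eb + s with hP₀
    have hQ : ‖P₀ + ((lo + R / 2 - ⟪P₀, ν⟫_ℝ) / ⟪W, ν⟫_ℝ) • W‖ ^ 2 -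
        ⟪P₀ + ((lo + R / 2 - ⟪P₀, ν⟫_ℝ) / ⟪W, ν⟫_ℝ) • W, ν⟫_ℝ ^ 2 ≤ (ρ - 1) ^ 2 := by
      rw [← norm_sub_inner_smul_sq ν _ hν]
      have hP₀ν : ⟪P₀, ν⟫_ℝ = (i : ℝ) * ⟪Ea, ν⟫_ℝ + (j : ℝ) * ⟪Eb, ν⟫_ℝ + ⟪s, ν⟫_ℝ := by
        rw [hP₀, inner_add_left, inner_add_left, inner_smul_left, inner_smul_left]; simp
      have heq : P₀ + ((lo + R / 2 - ⟪P₀, ν⟫_ℝ) / ⟪W, ν⟫_ℝ) • W -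
          ⟪P₀ + ((lo + R / 2 - ⟪P₀, ν⟫_ℝ) / ⟪W, ν⟫_ℝ) • W, ν⟫_ℝ • ν =
          c₀ + (i : ℝ) • X + (j : ℝ) • Y := by
        have hin : ⟪P₀ + ((lo + R / 2 - ⟪P₀, ν⟫_ℝ) / ⟪W, ν⟫_ℝ) • W, ν⟫_ℝ = m := by
          rw [inner_add_left, inner_smul_left]; simp only [conj_trivial]; rw [← hαdef, hmdef]
          field_simp; ring
        rw [hin, ← hmdef, hP₀ν, ← hαdef, hc₀, hX, hY, hP₀]
        have e1 : (m - ((i : ℝ) * ⟪Ea, ν⟫_ℝ + (j : ℝ) * ⟪Eb, ν⟫_ℝ + ⟪s, ν⟫_ℝ)) / α =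
            -((i : ℝ) * (⟪Ea, ν⟫_ℝ / α)) - (j : ℝ) * (⟪Eb, ν⟫_ℝ / α) + (m - ⟪s, ν⟫_ℝ) / α := by
          field_simp; ring
        rw [e1]
        module
      rw [heq]; exact hlat
    obtain ⟨t, ht1, ht2, ht3⟩ :=
      exists_int_mem_slabSample_window ν P₀ W hν hW.le hα0 R ρ lo hR hρ1 hQ
    have hpt : P₀ + (t : ℝ) • W = (i : ℝ) • Ea + (j : ℝ) • Eb + (t : ℝ) • W + s := by
      rw [hP₀]; abel
    rw [hpt] at ht1 ht2 ht3
    exact hT i j t ht1 ht2 ht3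
  -- assemble: √2|α| π (ρ-1-r)² ≤ #T
  have hmain : Real.sqrt 2 * |α| * (Real.pi * (ρ - 1 - r) ^ 2) ≤ (T.card : ℝ) := by
    have h := mul_le_mul_of_nonneg_left hdisc (by positivity : (0 : ℝ) ≤ Real.sqrt 2 * |α|)
    calc Real.sqrt 2 * |α| * (Real.pi * (ρ - 1 - r) ^ 2)
        ≤ Real.sqrt 2 * |α| * (|A.det| * (T.card : ℝ)) := h
      _ = (Real.sqrt 2 * |α| * |A.det|) * (T.card : ℝ) := by ring
      _ = (T.card : ℝ) := by rw [hdetabs, one_mul]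
  -- (ρ-1-r)² ≥ ρ² - 2(1+r)ρ and |α|(1+r) ≤ 5
  have hexp : Real.sqrt 2 * |α| * Real.pi * ρ ^ 2 - 10 * Real.sqrt 2 * Real.pi * ρ ≤
      Real.sqrt 2 * |α| * (Real.pi * (ρ - 1 - r) ^ 2) := by
    have e : Real.sqrt 2 * |α| * (Real.pi * (ρ - 1 - r) ^ 2) =
        Real.sqrt 2 * |α| * Real.pi * ρ ^ 2 - (2 * Real.sqrt 2 * Real.pi * ρ) * (|α| * (1 + r)) +
          Real.sqrt 2 * |α| * Real.pi * (1 + r) ^ 2 := by ring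
    have h3 : (2 * Real.sqrt 2 * Real.pi * ρ) * (|α| * (1 + r)) ≤ (2 * Real.sqrt 2 * Real.pi * ρ) * 5 :=
      mul_le_mul_of_nonneg_left hαr (by positivity)
    have h4 : 0 ≤ Real.sqrt 2 * |α| * Real.pi * (1 + r) ^ 2 := by positivity
    rw [e]
    linarith
  linarith

end Summit.Ventures.Crystal3D.Theorems

end
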